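import Mathlib
import Literature.Analysis.FluidPDE.Tao2016AveragedNS.ShiftSetCascadeFlows
import Literature.Analysis.FluidPDE.Tao2016AveragedNS.ShiftSetCascadeFlux
import Summits.NavierStokesRegularity.NavierStokesRegularity.Theorems.TaoLadderRungTwoFlatCertificateGlueChecksOn
import Summits.NavierStokesRegularity.NavierStokesRegularity.Theorems.TaoLadderRungTwoFlatCertificateGlueCheckerLandOn
import HarnessLib

/-!
# Certificate glue on a shift set `𝕊`, XXXVI: THE FINAL ASSEMBLY — the registered stub `stub_rung_quarter` (glue IX `stub_rung_quarter_of_checks`)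
  from a CHECKED LAYOUT-V CERTIFICATE: a finite family of branch chains (`checkStepV`, `checkTransit`, `checkSection`, `checkReadout`, sign and clock
  tests), a FINITE core family of reference states with the per-reference tests `checkRef` (core top, interior, cover by a start box) and `checkDatum`,
  the piecewise-Gaussian weight with `b = ½` as an exact rational table, and glue IX's finitely many scalar checks (left as real hypotheses)
  (helper for item stmt-NavierStokesRegularity-22987 `FlatGapCertificatesV2` (crux K_A♭ of route TaoLadderRungTwoFlat); cell harvest/h2-tao-ladder, p1 g16)

What the instance file still has to supply: the data (records, section records, readout constants, reference states, the ℚ constants), `native_decide`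
proofs of the Booleans, `norm_num`-type proofs of glue IX's scalar checks, and the equalities tying glue IX's envelope values `Zf(−Kb−1)`, `Zb(−Kb−1)`,
`ν(Ka+1)·r/w_Ka` to the rationals `Eb`, `Zx`, `Et` used by the checkers.

HONEST FRAMING: Tao-type MODEL lattice `T♭(½)` on `S♭` at `ε₀ = ¼`; soundness of the certificate FORMAT — NO certificate instance exists in the tree,
nothing is certified here, no stub is closed by this file, nothing here is a statement about the Navier–Stokes equations.
-/

noncomputable section

-- the sub-problem namespace repeats the summit name by design (D-0017)
set_option linter.dupNamespace false

namespace Summit.NavierStokesRegularity.NavierStokesRegularity.Theorems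

open Set Finset Literature.Analysis.FluidPDE Literature.Analysis.FluidPDE.TaoCascade
open Summit.NavierStokesRegularity.NavierStokesRegularity.Theorems.TaylorModelCert

namespace CertificateGlueOn

/-! ### The table and the shift set as exact data -/

/-- The rational mirror-seeded Toda table (twin of `mirrorTable`). [cite: Tao2016AveragedNS, §4 (4.1) (structure constants); route TaoLadderRungTwoFlat, posited table] -/
def mirrorTableQ (ε δ : ℚ) : Fin 2 → Fin 2 → Fin 2 → ℤ × ℤ × ℤ → ℚ := fun i₁ i₂ i₃ μ =>
  if μ = (0, 0, 0) then
    (if i₁ = 1 ∧ i₂ = 1 ∧ i₃ = 0 then -1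
      else if i₁ = 1 ∧ i₂ = 0 ∧ i₃ = 1 then 1 / 2
      else if i₁ = 0 ∧ i₂ = 1 ∧ i₃ = 1 then 1 / 2
      else if i₁ = 0 ∧ i₂ = 0 ∧ i₃ = 1 then ε
      else if i₁ = 0 ∧ i₂ = 1 ∧ i₃ = 0 then -ε / 2
      else if i₁ = 1 ∧ i₂ = 0 ∧ i₃ = 0 then -ε / 2
      else 0)
  else if μ = (0, 0, 1) then (if i₁ = 1 ∧ i₂ = 1 ∧ i₃ = 0 then 1 else 0)
  else if μ = (0, 1, 0) then (if i₁ = 1 ∧ i₂ = 0 ∧ i₃ = 1 then -1 / 2 else 0)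
  else if μ = (1, 0, 0) then (if i₁ = 0 ∧ i₂ = 1 ∧ i₃ = 1 then -1 / 2 else 0)
  else if μ = (1, 1, 0) then (if i₁ = 0 ∧ i₂ = 0 ∧ i₃ = 1 then -δ else 0)
  else if μ = (1, 0, 1) then (if i₁ = 0 ∧ i₂ = 1 ∧ i₃ = 0 then δ / 2 else 0)
  else if μ = (0, 1, 1) then (if i₁ = 1 ∧ i₂ = 0 ∧ i₃ = 0 then δ / 2 else 0)
  else 0

/-- The rational table casts to `mirrorTable ½ ½`. [folklore] -/
theorem cast_mirrorTableQ_half : (fun i₁ i₂ i μ => ((mirrorTableQ (1 / 2) (1 / 2) i₁ i₂ i μ : ℚ) : ℝ)) = mirrorTable (1 / 2) (1 / 2) := by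
  funext i₁ i₂ i μ
  simp only [mirrorTableQ, mirrorTable]
  split_ifs <;> push_cast <;> ring

/-- `S♭` as a list. [folklore] -/
def shiftsFlat : List (ℤ × ℤ × ℤ) := [(0, 0, 0), (1, 0, 0), (0, 1, 0), (0, 0, 1), (1, 1, 0), (1, 0, 1), (0, 1, 1)]

/-- The list is duplicate-free. [folklore] -/
theorem shiftsFlat_nodup : shiftsFlat.Nodup := by decide

/-- The list enumerates `S♭`. [folklore] -/
theorem shiftsFlat_toFinset : shiftsFlat.toFinset = shiftSetFlat := by decide

/-! ### The piecewise-Gaussian weight with `b = ½` as a rational table -/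

/-- `w_k = Cw·2^{k(k+1)/2}` for `k ≥ 0`, `Cw` for `k < 0`. [folklore] -/
def pgaussW (Cw : ℚ) (k : ℤ) : ℚ := if k < 0 then Cw else Cw * 2 ^ (k * (k + 1) / 2).toNat

/-- The rational weight is glue IX's `Cw·2^{k²/2 + k/2}` for `k ≥ 0`. [folklore] -/
theorem pgaussW_of_nonneg (Cw : ℚ) {k : ℤ} (hk : 0 ≤ k) :
    ((pgaussW Cw k : ℚ) : ℝ) = (Cw : ℝ) * (2 : ℝ) ^ ((k : ℝ) ^ 2 / 2 + (1 / 2 : ℝ) * k) := by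
  have h2 : (2 : ℤ) ∣ k * (k + 1) := (Int.even_mul_succ_self k).two_dvd
  have hnn : 0 ≤ k * (k + 1) / 2 := Int.ediv_nonneg (by nlinarith) (by norm_num)
  have e : ((k : ℝ) ^ 2 / 2 + (1 / 2 : ℝ) * k) = (((k * (k + 1) / 2 : ℤ)) : ℝ) := by
    rw [Int.cast_div h2 (by norm_num)]; push_cast; ring
  rw [e, Real.rpow_intCast, pgaussW, if_neg (not_lt.mpr hk)]
  push_cast
  rw [← zpow_natCast, Int.toNat_of_nonneg hnn]

/-- The rational weight is constant `Cw` for `k < 0`. [folklore] -/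
theorem pgaussW_of_neg (Cw : ℚ) {k : ℤ} (hk : k < 0) : ((pgaussW Cw k : ℚ) : ℝ) = (Cw : ℝ) := by
  rw [pgaussW, if_pos hk]

/-! ### The finite core family and its per-reference tests -/

variable {Kb Ka : ℤ}

/-- **The core family**: states agreeing on the window with one of finitely many reference tables. [folklore] -/
def coreFam (Kb Ka : ℤ) {L : ℕ} (refs : Fin L → Array Dyad) : (Fin 2 → ℤ → ℝ) → Prop := fun z =>
  ∃ l : Fin L, ∀ i k, -Kb ≤ k → k ≤ Ka → z i k = zstate (m := 2) Kb Ka (refs l) i k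

/-- **The per-reference test**: on the window, positive weights, the interior clause `|z| + r/w_k < M_k`, the cover of the weighted `r`-ball by the
start box `(x0, r0)` of the assigned branch, and the top clause `4 w_Ka |z_{i,Ka}| ≤ r`. [folklore] -/
def checkRef (Kb Ka : ℤ) (ωq : Fin 2 → ℤ → ℚ) (wq Mq : ℤ → ℚ) (r : ℚ) (zc x0 r0 : Array Dyad) : Bool :=
  let W := winLen Kb Ka
  (List.finRange 2).all fun i => (List.range W).all fun cc =>
    let k : ℤ := (cc : ℤ) - Kb
    let d := cc + W * i.val
    decide (0 < wq k) && decide (|dyadToRat (dgetD zc d)| + r / wq k < Mq k) &&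
    decide (|dyadToRat (dgetD zc d) / ωq i k - dyadToRat (dgetD x0 d)| + r / (wq k * ωq i k) ≤ dyadToRat (dgetD r0 d)) &&
    (decide (k ≠ Ka) || decide (4 * (wq Ka * |dyadToRat (dgetD zc d)|) ≤ r))

/-- **The datum test**: the reference table `zc` is the window table of `datumState 0 X₀`, `X₀ = x0q`. [folklore] -/
def checkDatum (Kb Ka : ℤ) (x0q : Fin 2 → ℚ) (zc : Array Dyad) : Bool :=
  (List.finRange 2).all fun i => (List.range (winLen Kb Ka)).all fun cc =>
    decide (dyadToRat (dgetD zc (cc + winLen Kb Ka * i.val)) = (if ((cc : ℤ) - Kb) = 0 then x0q i else 0) / |x0q 0|)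

/-- Unpacking `checkRef` at a window pair. [folklore] -/
theorem checkRef_at {ωq : Fin 2 → ℤ → ℚ} {wq Mq : ℤ → ℚ} {r : ℚ} {zc x0 r0 : Array Dyad} (h : checkRef Kb Ka ωq wq Mq r zc x0 r0 = true)
    (i : Fin 2) {k : ℤ} (hw : -Kb ≤ k ∧ k ≤ Ka) :
    0 < wq k ∧ |dyadToRat (dgetD zc (idxOf Kb Ka i k hw))| + r / wq k < Mq k ∧
      |dyadToRat (dgetD zc (idxOf Kb Ka i k hw)) / ωq i k - dyadToRat (dgetD x0 (idxOf Kb Ka i k hw))| + r / (wq k * ωq i k) ≤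
        dyadToRat (dgetD r0 (idxOf Kb Ka i k hw)) ∧
      (k = Ka → 4 * (wq Ka * |dyadToRat (dgetD zc (idxOf Kb Ka i k hw))|) ≤ r) := by
  simp only [checkRef, List.all_eq_true, List.mem_finRange, List.mem_range, Bool.and_eq_true, Bool.or_eq_true, decide_eq_true_eq,
    true_implies] at h
  have hcc : (k + Kb).toNat < winLen Kb Ka := by unfold winLen; rw [Int.toNat_lt_toNat (by omega)]; omega
  obtain ⟨⟨⟨h1, h2⟩, h3⟩, h4⟩ := h i (k + Kb).toNat hcc
  rw [Int.toNat_of_nonneg (by omega), show k + Kb - Kb = k by ring] at h1 h2 h3 h4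
  rw [idxOf_val i hw]
  refine ⟨h1, h2, h3, fun hk => ?_⟩
  rcases h4 with h4 | h4
  · exact absurd hk h4
  · exact h4

/-- The three consequences of `checkRef` for a state `S₀` in the weighted `r`-ball of the reference state. [folklore] -/
theorem ref_consequences {ωq : Fin 2 → ℤ → ℚ} (hω : ∀ i k, 0 < ωq i k) {wq Mq : ℤ → ℚ} {r : ℚ} {zc x0 r0 : Array Dyad}
    (hKb : 0 ≤ Kb) (hKa : 1 ≤ Ka) (h : checkRef Kb Ka ωq wq Mq r zc x0 r0 = true) {z S₀ : Fin 2 → ℤ → ℝ}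
    (hz : ∀ i k, -Kb ≤ k → k ≤ Ka → z i k = zstate (m := 2) Kb Ka zc i k)
    (hS : ∀ i k, -Kb ≤ k → k ≤ Ka → (wq k : ℝ) * |S₀ i k - z i k| ≤ (r : ℝ)) :
    (∀ i k, -Kb ≤ k → k ≤ Ka → |S₀ i k| < (Mq k : ℝ)) ∧
      (∀ d, |pxcoord Kb Ka (fun i k => (ωq i k : ℝ)) S₀ d - dvec (n := 2 * winLen Kb Ka) x0 d| ≤ dvec (n := 2 * winLen Kb Ka) r0 d) := by
  have hKK : 0 ≤ Ka + Kb + 1 := by omega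
  have key : ∀ (i : Fin 2) (k : ℤ) (hw : -Kb ≤ k ∧ k ≤ Ka),
      |S₀ i k| < (Mq k : ℝ) ∧
      |pxcoord Kb Ka (fun i k => (ωq i k : ℝ)) S₀ (idxOf Kb Ka i k hw) - dvec (n := 2 * winLen Kb Ka) x0 (idxOf Kb Ka i k hw)| ≤
        dvec (n := 2 * winLen Kb Ka) r0 (idxOf Kb Ka i k hw) := by
    intro i k hw
    obtain ⟨h1, h2, h3, -⟩ := checkRef_at h i hw
    have hwk : (0 : ℝ) < (wq k : ℝ) := by exact_mod_cast h1
    have hωk : (0 : ℝ) < (ωq i k : ℝ) := by exact_mod_cast hω i k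
    have hzv : z i k = (dgetD zc (idxOf Kb Ka i k hw)).toReal := by rw [hz i k hw.1 hw.2]; unfold zstate; rw [dif_pos hw]
    have hd : |S₀ i k - z i k| ≤ (r : ℝ) / (wq k : ℝ) := by
      rw [le_div_iff₀ hwk, mul_comm]; exact hS i k hw.1 hw.2
    set Z : ℝ := (dgetD zc (idxOf Kb Ka i k hw)).toReal
    have h2r := (Rat.cast_lt (K := ℝ)).mpr h2
    have h3r := (Rat.cast_le (K := ℝ)).mpr h3
    simp only [Rat.cast_add, Rat.cast_abs, Rat.cast_div, Rat.cast_sub, Rat.cast_mul, cast_dyadToRat] at h2r h3r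
    rw [hzv] at hd
    refine ⟨?_, ?_⟩
    · have : |S₀ i k| ≤ |Z| + (r : ℝ) / (wq k : ℝ) := by
        have := abs_add_le (S₀ i k - Z) Z; rw [sub_add_cancel] at this; linarith [abs_sub_comm (S₀ i k) Z]
      exact this.trans_lt h2r
    · rw [pxcoord_idxOf S₀ i hw]
      simp only [dvec]
      have e : S₀ i k / (ωq i k : ℝ) - (dgetD x0 (idxOf Kb Ka i k hw)).toReal =
          (Z / (ωq i k : ℝ) - (dgetD x0 (idxOf Kb Ka i k hw)).toReal) + (S₀ i k - Z) / (ωq i k : ℝ) := by ring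
      rw [e]
      refine (abs_add_le _ _).trans (le_trans (add_le_add le_rfl ?_) h3r)
      rw [abs_div, abs_of_pos hωk, div_le_iff₀ hωk]
      calc |S₀ i k - Z| ≤ (r : ℝ) / (wq k : ℝ) := hd
        _ = (r : ℝ) / ((wq k : ℝ) * (ωq i k : ℝ)) * (ωq i k : ℝ) := by field_simp
  refine ⟨fun i k hk1 hk2 => (key i k ⟨hk1, hk2⟩).1, fun d => ?_⟩
  obtain ⟨hk1, hk2⟩ := shellAt_mem hKK (finProdFinEquiv.symm d).2
  have hw : -Kb ≤ shellAt Kb (finProdFinEquiv.symm d).2 ∧ shellAt Kb (finProdFinEquiv.symm d).2 ≤ Ka := ⟨hk1, hk2⟩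
  have hd : idxOf Kb Ka (finProdFinEquiv.symm d).1 (shellAt Kb (finProdFinEquiv.symm d).2) hw = d := by
    apply Fin.ext
    rw [idxOf_val _ hw, ← val_eq_of_symm d]
  have := (key (finProdFinEquiv.symm d).1 _ hw).2
  rwa [hd] at this

/-! ### The final assembly -/

/-- **THE REGISTERED STUB `stub_rung_quarter` FROM A CHECKED LAYOUT-V CERTIFICATE** (see the module docstring): glue IX `stub_rung_quarter_of_checks` with
`htrap` := glue XXIX-c `htrap_of_chainChecksV`, `hland` := glue XXXV `hland_of_chainChecksV`, the core `Z := coreFam refs`, and `hcore` / `hdatum` /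
`hcoreTop` / `hinside` / `hcover` from `checkRef` / `checkDatum`.
[cite: Tao2016AveragedNS, §6.3–6.4 Props. 6.4–6.5 (statement shape of a renormalisation certificate); route TaoLadderRungTwoFlat, crux K_A♭, stub_rung_quarter, certificate format] -/
theorem stub_rung_quarter_of_certificateV
    -- window, datum, weights in the coordinates
    {Kb Ka : ℤ} (hKb : 0 ≤ Kb) (hKa : 4 ≤ Ka) {x0q : Fin 2 → ℚ} (hx0 : x0q 0 ≠ 0) {ωq : Fin 2 → ℤ → ℚ} (hω : ∀ i k, 0 < ωq i k)
    -- glue IX's reals, tied to rationals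
    {M w : ℤ → ℝ} {Mq wq : ℤ → ℚ} (hM : ∀ k, M k = (Mq k : ℝ)) (hwq : ∀ k, w k = (wq k : ℝ))
    {r ρ θ₀ θ c₀ c σ : ℝ} {rq ρq c₀q cq σq : ℚ} {θn θd : ℕ} (hrq : r = (rq : ℝ)) (hρq : ρ = (ρq : ℝ))
    (hθ₀q : θ₀ = (θn : ℝ) / (θd : ℝ)) (hc₀q : c₀ = (c₀q : ℝ)) (hcq : c = (cq : ℝ)) (hσq : σ = (σq : ℝ))
    (hr : 0 < r) (hρ : 0 ≤ ρ) (hρ1 : ρ < 1) (hθ₀ : 0 ≤ θ₀) (hθ₀θ : θ₀ < θ) (hθ : θ ≤ 1 / 2) (hc₀ : 0 < c₀) (hc₀c : c₀ < c) (hσ : 0 < σ)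
    {Mmax : ℝ} (hMmax : ∀ k, -Kb ≤ k → k ≤ Ka → M k ≤ Mmax)
    -- the piecewise-Gaussian weight
    {Cw b : ℝ} (hCw : 1 ≤ Cw) (hb : 1 / 2 ≤ b)
    (hwp : ∀ k : ℤ, 0 ≤ k → w k = Cw * (2 : ℝ) ^ ((k : ℝ) ^ 2 / 2 + b * k)) (hwn : ∀ k : ℤ, k < 0 → w k = Cw)
    -- wake side
    {Zb Zf : ℤ → ℝ} {Cb γ : ℝ} (hCb : 0 < Cb) (hγ0 : 0 ≤ γ) (hγ1 : γ ≤ 1)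
    (hZb : ∀ j : ℤ, Zb j = Cb * (1 + (1 / 4 : ℝ)) ^ (-(γ * j)))
    (hZf : ∀ j : ℤ, Zf j = 2 * (Zb j + r / Cw)) (hMZf : M (-Kb) ≤ Zf (-Kb))
    (checkB₁ : 32 * c * 28 * (1 + (1 / 4 : ℝ)) ^ (2 * γ) *
      ((1 + (1 / 4 : ℝ)) ^ ((5 : ℝ) * ((-Kb - 1 : ℤ) : ℝ) / 2) * (Zb (-Kb - 1) + r / Cw)) ≤ 1)
    (checkB₂ : (1 + (1 / 4 : ℝ)) ^ θ₀ * (Zb (-Kb - 1) + r / Cw +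
      32 * c * 28 * (1 + (1 / 4 : ℝ)) ^ (2 * γ) *
        ((1 + (1 / 4 : ℝ)) ^ ((5 : ℝ) * ((-Kb - 1 : ℤ) : ℝ) / 2) * (Zb (-Kb - 1) + r / Cw) ^ 2)) ≤ Zb (-Kb - 1 - 1))
    -- quiet side
    {ν : ℤ → ℝ} {ν₀ ν₁ ϑ : ℝ}
    (hνKa : ν Ka = ν₀) (hνhi : ∀ K : ℤ, Ka + 1 ≤ K → ν K = ν₁) (hν₀ : 0 ≤ ν₀) (hν₁ : 0 ≤ ν₁)
    (hMν : M Ka ≤ ν₀ * r / w (Ka - 1))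
    (checkA₁ : (1 + (1 / 4 : ℝ)) ^ ((5 : ℝ) * ((Ka + 1 : ℤ) : ℝ) / 2) * r * w (Ka + 1 - 1) ≤ ϑ * w (Ka + 1 - 2) ^ 2)
    (checkA₂ : (1 + (1 / 4 : ℝ)) ^ ((5 : ℝ) * ((Ka : ℤ) : ℝ) / 2) *
      coeffAbsOn (botShifts shiftSetFlat) (mirrorTable (1 / 2) (1 / 2)) * c * (ν₀ * r / w (Ka - 1)) ≤ 1 / 2)
    (checkA₃ : (1 + (1 / 4 : ℝ)) ^ ((5 : ℝ) * ((Ka + 1 : ℤ) : ℝ) / 2) *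
      coeffAbsOn (botShifts shiftSetFlat) (mirrorTable (1 / 2) (1 / 2)) * c * (ν₁ * r / w Ka) ≤ 1 / 2)
    (checkA₄ : 2 * (Real.sqrt 2 * Real.sqrt (4 / 3 * (2 : ℕ) * (25 / 32)) / (2 * (1 + (1 / 4 : ℝ)) ^ ((Ka : ℤ) : ℝ)) +
      coeffAbsOn (botShifts shiftSetFlat) (mirrorTable (1 / 2) (1 / 2)) * c *
        (ϑ / (1 + (1 / 4 : ℝ)) ^ ((5 : ℝ) / 2)) * ν₀ ^ 2) ≤ ν₁)
    (checkA₅ : 2 * (Real.sqrt 2 * Real.sqrt (4 / 3 * (2 : ℕ) * (25 / 32)) / (2 * (1 + (1 / 4 : ℝ)) ^ ((Ka + 1 : ℤ) : ℝ)) +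
      coeffAbsOn (botShifts shiftSetFlat) (mirrorTable (1 / 2) (1 / 2)) * c *
        (ϑ / (1 + (1 / 4 : ℝ)) ^ ((5 : ℝ) / 2)) * ν₁ ^ 2) ≤ ν₁)
    (checkA₆ : ν₁ * (1 + (1 / 4 : ℝ)) ^ θ₀ ≤ ρ)
    -- the envelope values used by the checkers
    {Eb Et Zx lev : ℚ} (hEb : Zf (-Kb - 1) = (Eb : ℝ)) (hEt : ν (Ka + 1) * r / w Ka = (Et : ℝ)) (hZx : Zb (-Kb - 1) = (Zx : ℝ))
    -- THE CERTIFICATE: global data, branch chains, section records, readout constants, reference states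
    {prec p kexp nexp : ℕ} {Sp Sm : IntervalD} {bD : Dyad}
    {ι : Type*} {rec : ι → ℕ → VRec} {N j₁ j₂ : ι → ℕ} {sr : ι → ℕ → SecRec} {qz : Array ℤ} {a : ι → ℕ → ℚ}
    {L : ℕ} {refs : Fin L → Array Dyad} {start : Fin L → ι} {tgt : ι → ℕ → Fin L} {l₀ : Fin L}
    (hg : checkGlobal 2 Kb Ka prec shiftsFlat (mirrorTableQ (1 / 2) (1 / 2)) ωq (1 / 4) Sp Sm bD = true)
    (hs : ∀ bb j, j < N bb → checkStepV 2 Kb Ka prec p kexp nexp shiftsFlat (mirrorTableQ (1 / 2) (1 / 2)) ωq Sp Sm bD Eb Et (rec bb) j = true)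
    (htr : ∀ bb j, j < N bb → checkTransit 2 Kb Ka ωq Mq (rec bb j).lo (rec bb j).hi = true)
    (hcN : ∀ bb, cq ≤ sumHV (rec bb) (N bb))
    (hj : ∀ bb, j₁ bb ≤ j₂ bb) (hjN : ∀ bb, j₂ bb < N bb)
    (hsec : ∀ bb j, j₁ bb ≤ j → j ≤ j₂ bb →
      checkSection 2 Kb Ka prec shiftsFlat (coefBoxOf prec (mirrorTableQ (1 / 2) (1 / 2)) ωq Sp Sm) qz (rec bb j).lo (rec bb j).hi (rec bb j).δ
        (sr bb j) = true)
    (hread : ∀ bb j, j₁ bb ≤ j → j ≤ j₂ bb →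
      checkReadout 2 Kb Ka ωq 0 (1 / 4) σq (a bb j) ρq rq Zx Et θn θd wq (refs (tgt bb j))
        (xsArr (2 * winLen Kb Ka) qz (sr bb j) (rec bb j).x lev)
        (rsArr (2 * winLen Kb Ka) qz (sr bb j) (rec bb j).E (rec bb j).r (rec bb j).C (rec bb j).h) = true)
    (hbefore : ∀ bb, checkSecBelow (2 * winLen Kb Ka) qz (rec bb (j₁ bb)) lev = true)
    (hafter : ∀ bb, checkSecAbove (2 * winLen Kb Ka) qz (rec bb (j₂ bb + 1)) lev = true)
    (hpos : ∀ bb, 0 < sumHV (rec bb) (j₁ bb)) (hc₀N : ∀ bb, sumHV (rec bb) (j₂ bb + 1) ≤ c₀q)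
    (hid : ∀ bb, checkIdFrame (2 * winLen Kb Ka) (rec bb 0).C = true) (hE : ∀ bb, checkNonneg (2 * winLen Kb Ka) (rec bb 0).E = true)
    (hrefs : ∀ l, checkRef Kb Ka ωq wq Mq rq (refs l) (rec (start l) 0).x (rec (start l) 0).r = true)
    (hdat : checkDatum Kb Ka x0q (refs l₀) = true) :
    ∃ (σ : ℝ) (X₀ : Fin 2 → ℝ) (Z : Set (Fin 2 → ℤ → ℝ)) (w : ℤ → ℝ) (r ρ θ₀ θ c₀ c : ℝ) (env₀ : ℤ → ℝ),
      X₀ 0 ≠ 0 ∧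
        GapData₂On shiftSetFlat σ (1 / 4) (0 : Fin 2) (mirrorTable (1 / 2) (1 / 2)) X₀ Z w r ρ θ₀ θ c₀ c env₀ ∧
          TailThin (1 / 4) w r ∧
            ∃ (Cw b : ℝ), 1 ≤ Cw ∧ 1 / 2 ≤ b ∧ ∀ k : ℤ, 0 ≤ k → w k = Cw * (2 : ℝ) ^ ((k : ℝ) ^ 2 / 2 + b * k) := by
  -- tie the reals to the rationals
  have hMfun : M = fun k => (Mq k : ℝ) := funext hM
  have hwfun : w = fun k => (wq k : ℝ) := funext hwq
  subst hMfun hwfun hrq hρq hθ₀q hc₀q hcq hσq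
  have hKa1 : 1 ≤ Ka := by omega
  have hq : (0 : ℝ) < 1 + ((1 / 4 : ℚ) : ℝ) := by push_cast; norm_num
  have hqe : ((1 / 4 : ℚ) : ℝ) = (1 / 4 : ℝ) := by push_cast; ring
  have h𝕊 : IsNearestNeighbourSet shiftsFlat.toFinset := by rw [shiftsFlat_toFinset]; exact isNearestNeighbourSet_shiftSetFlat
  -- the datum and the core
  set X₀ : Fin 2 → ℝ := fun i => (x0q i : ℝ) with hX₀def
  have hX₀ : X₀ 0 ≠ 0 := by simp only [hX₀def]; exact_mod_cast hx0
  set Core : (Fin 2 → ℤ → ℝ) → Prop := coreFam Kb Ka refs with hCore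
  have hcore : ∀ z z' : Fin 2 → ℤ → ℝ, (∀ i k, -Kb ≤ k → k ≤ Ka → z i k = z' i k) → Core z → Core z' := by
    intro z z' hzz' ⟨l, hl⟩
    exact ⟨l, fun i k hk1 hk2 => (hzz' i k hk1 hk2).symm.trans (hl i k hk1 hk2)⟩
  have hdatum : Core (datumState (0 : Fin 2) X₀) := by
    refine ⟨l₀, fun i k hk1 hk2 => ?_⟩
    have hw : -Kb ≤ k ∧ k ≤ Ka := ⟨hk1, hk2⟩
    simp only [checkDatum, List.all_eq_true, List.mem_finRange, List.mem_range, decide_eq_true_eq, true_implies] at hdat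
    have hcc : (k + Kb).toNat < winLen Kb Ka := by unfold winLen; rw [Int.toNat_lt_toNat (by omega)]; omega
    have h1 := hdat i (k + Kb).toNat hcc
    rw [Int.toNat_of_nonneg (by omega), show k + Kb - Kb = k by ring] at h1
    unfold zstate; rw [dif_pos hw, idxOf_val i hw, ← cast_dyadToRat, h1]
    simp only [datumState, hX₀def]
    push_cast
    split_ifs <;> simp
  have hcoreTop : ∀ z, Core z → ∀ i, 4 * ((wq Ka : ℝ) * |z i Ka|) ≤ (rq : ℝ) := by
    intro z ⟨l, hl⟩ i
    have hw : -Kb ≤ Ka ∧ Ka ≤ Ka := ⟨by omega, le_rfl⟩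
    obtain ⟨-, -, -, h4⟩ := checkRef_at (hrefs l) i hw
    have h4r := (Rat.cast_le (K := ℝ)).mpr (h4 rfl)
    simp only [Rat.cast_mul, Rat.cast_abs, Rat.cast_ofNat, cast_dyadToRat] at h4r
    rw [hl i Ka hw.1 hw.2]; unfold zstate; rw [dif_pos hw]
    exact h4r
  have hinside : ∀ (z S₀ : Fin 2 → ℤ → ℝ), Core z →
      (∀ i k, -Kb ≤ k → k ≤ Ka → (wq k : ℝ) * |S₀ i k - z i k| ≤ (rq : ℝ)) → ∀ i k, -Kb ≤ k → k ≤ Ka → |S₀ i k| < (Mq k : ℝ) :=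
    fun z S₀ ⟨l, hl⟩ hS => (ref_consequences hω hKb hKa1 (hrefs l) hl hS).1
  have hcover : ∀ (z S₀ : Fin 2 → ℤ → ℝ), Core z → (∀ i k, -Kb ≤ k → k ≤ Ka → (wq k : ℝ) * |S₀ i k - z i k| ≤ (rq : ℝ)) →
      ∃ bb, ∀ d, |pxcoord Kb Ka (fun i k => (ωq i k : ℝ)) S₀ d - dvec (n := 2 * winLen Kb Ka) (rec bb 0).x d| ≤
        dvec (n := 2 * winLen Kb Ka) (rec bb 0).r d :=
    fun z S₀ ⟨l, hl⟩ hS => ⟨start l, (ref_consequences hω hKb hKa1 (hrefs l) hl hS).2⟩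
  -- the two dynamic clauses from the chain checkers
  have htrap0 := htrap_of_chainChecksV (Core := Core) (w := fun k => (wq k : ℝ)) (r := (rq : ℝ)) hKb hKa1 shiftsFlat_nodup h𝕊 hω
    (c := cq) (Mq := Mq) hg hs htr hcN hid hE hcover
  have hland0 := hland_of_chainChecksV (Core := Core) (w := wq) (r := rq) hKb hKa1 shiftsFlat_nodup h𝕊 hq hω (lev := lev) (c₀ := c₀q)
    (Mq := Mq) (i₀ := (0 : Fin 2)) (σ := σq) (ρ := ρq) (Zx := Zx) (θn := θn) (θd := θd) (a := a) (zc := fun bb j => refs (tgt bb j))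
    hg hj (fun bb j hjb => hs bb j (by have := hjN bb; omega)) hsec hread (fun bb j _ _ => ⟨tgt bb j, fun i k _ _ => rfl⟩) hbefore hafter hpos
    hc₀N hid hE hcover
  rw [shiftsFlat_toFinset, cast_mirrorTableQ_half, hqe] at htrap0 hland0
  rw [← hZx] at hland0
  refine stub_rung_quarter_of_checks hX₀ hKb hKa hr hρ hρ1 hθ₀ hθ₀θ hθ hc₀ hc₀c hσ hMmax hcore hdatum hCw hb hwp hwn hCb hγ0 hγ1 hZb hZf
    hMZf checkB₁ checkB₂ hcoreTop hνKa hνhi hν₀ hν₁ hMν checkA₁ checkA₂ checkA₃ checkA₄ checkA₅ checkA₆ hinside ?_ ?_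
  · intro s z S hz hs0 hsc hS0 hd hcb hct hbb hbt hMb
    exact htrap0 s z S hz hs0 hsc hS0 hd hcb hct (fun i u hu => (hbb i u hu).trans_eq hEb) (fun i u hu => (hbt i u hu).trans_eq hEt) hMb
  · intro z S hz hS0 hd hcb hct hbb hbt hMb
    obtain ⟨τ₁, a', z', h1, h2, h3, h4, h5, h6, h7, h8, h9⟩ :=
      hland0 z S hz hS0 hd hcb hct (fun i u hu => (hbb i u hu).trans_eq hEb) (fun i u hu => (hbt i u hu).trans_eq hEt) hMb
    exact ⟨τ₁, a', z', h1, h2, h3, h4, h5, h6, h7, fun i v hv => h8 i v (hv.trans_eq hEt), h9⟩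

end CertificateGlueOn

end Summit.NavierStokesRegularity.NavierStokesRegularity.Theorems

end
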